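import Literature.NumberTheory.PAdicHodge.TateH1Cocycle
import Literature.NumberTheory.PAdicHodge.TateSenCocycles
import Literature.IUT.LogVolume.LogSeriesEstimates
import Literature.IUT.LogVolume.UnitLogKernel
import Mathlib.NumberTheory.Padics.ProperSpace
import HarnessLib

/-!
# Tate 1967 §3.3 Theorem 1 at `λ = log χ_cyclo`: `H¹_cont(Gal(F̄/ℚ_p), ℂ_F) = ℚ_p · log χ_cyclo`
# (for cocycles trivial on `Gal(F̄/ℚ_p(μ_{p^∞}))` — PROVED; for all continuous cocycles — GRANTED (TS1))

Continuation of `TateH1Cocycle` (`TateH1.exists_eq_mul_add_coboundary`: a continuous cocycle of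
`G₀ = Gal(F̄/K₀)`, `K₀ = PadicBase F p hp ≅ ℚ_p`, trivial on `H = Gal(F̄/K₀(μ_{p^∞}))` is `c · λ + ∂b` for ANY
continuous additive `λ : G₀ → K₀` killing `H` with `λ(γ) ≠ 0`). Here the canonical `λ = log χ_cyclo` is supplied:

* `TateH1.continuousOn_unitLog_sphere` — the `p`-adic logarithm `log_p` (tree `IUT.LogVolume.unitLog`) is
  continuous on the unit sphere of `ℚ_p` (`‖log_p u − log_p u₀‖ ≤ ‖u − u₀‖` at distance `≤ p⁻¹`, from the tree's
  Lipschitz bound `norm_logSeries_le_norm`).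
* `TateH1.continuous_logChi`, `logChi_mul`, `logChi_eq_zero_of_forall_smul_zeta`, `logChi_gen_ne_zero` —
  `g ↦ log_p χ(g) ∈ K₀` is continuous (Mathlib `cyclotomicCharacter.continuous` + the above), additive, kills `H`,
  and is `≠ 0` at `γ = gen n` (`n ≥ 2`; `χ(γ)` has infinite order, tree `zpow_chi_gen_ne_one` +
  `unitLog_eq_zero_iff`).
* **`TateH1.exists_eq_mul_logChi_add_coboundary`** — Tate's theorem for cocycles trivial on `H`:
  `f(g) = ι(c · log_p χ(g)) + (g • b − b)`. UNCONDITIONAL.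
* **`TateH1.exists_eq_mul_logChi_add_coboundary_of_TS1`** — the same for EVERY continuous cocycle
  `f : G₀ → ℂ_F`, GRANTED the Tate–Sen axiom (TS1) for `ℂ_F` displayed as the hypothesis `hTS` (consumed through
  edix-p4's `TateSen.baseKer_exists_eq_smul_sub_of_TS1`: `f|_{ker χ} = ∂b₀`, and `H ⊆ ker χ`).

Together with the tree's `CompletedAlgClosure.not_exists_smul_eq_add_logCyclotomic` (the class of `log χ` is not
a coboundary) this is `dim_{ℚ_p} H¹_cont(G₀, ℂ_F) = 1` granted (TS1) — brick b6 of the `hasDualExp_of_isDeRham`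
programme (Kato 1993 II §1.2.3 (b)); the transfer to `Γ_F = Gal(F̄/F)` (b5) and (TS1) itself (b2) are separate.

## References
* J. Tate, *p-divisible groups* (1967), §3.2 Prop. 9–10, §3.3 Theorem 1. [Tate1967]
* J.-M. Fontaine, Y. Ouyang, *Theory of p-adic Galois representations*, §3.2 Thm. 3.21. [FontaineOuyang2022]
* L. Berger, P. Colmez, *Familles de représentations de de Rham et monodromie p-adique* (2008), §3.1–4.1. [BergerColmez2008]
* N. Koblitz, *p-adic numbers, p-adic analysis, and zeta-functions* (1984), Ch. IV §1. [Koblitz1984]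
* K. Kato, *Lectures on the approach to Iwasawa theory for Hasse–Weil L-functions via B_dR* (1993), Ch. II §1.2. [Kato1993LNM1553]
-/

noncomputable section

open ValuativeRel Field UniformSpace Filter Topology Finset

open scoped IntermediateField

namespace Literature.NumberTheory.PAdicHodge

open Literature.NumberTheory.GaloisRepresentations
open Literature.NumberTheory.GaloisRepresentations.IsNonarchimedeanLocalField
open CyclotomicTower TateTrace

variable {F : Type} [Field F] [ValuativeRel F] [TopologicalSpace F] [IsNonarchimedeanLocalField F]
  [CharZero F] {p : ℕ} [Fact p.Prime] (hp : valuation F p < 1)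

namespace TateH1

/-! ### `log χ_cyclo` on `G₀`: additive, continuous, trivial on `H`, non-zero at `γ` -/

/-- `K₀ = PadicBase F p hp` carries the topology of `ℚ_p`: the identification `ℚ_p → K₀` is continuous
(`‖x‖_{K₀} ≤ 1 ↔ ‖x‖_p ≤ 1`, and `p^k ℤ_p ↦` the ball of radius `‖p‖^k`). [folklore] -/
private theorem continuous_toPadic_symm : Continuous (PadicBase.toPadic hp).symm := by
  have hp0 := PadicBase.norm_p_pos hp
  have hp1 := PadicBase.norm_p_lt_one hp
  have hP : Fact p.Prime := inferInstance
  refine continuous_of_continuousAt_zero (PadicBase.toPadic hp).symm.toAddMonoidHom ?_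
  rw [ContinuousAt, map_zero, Metric.tendsto_nhds_nhds]
  intro ε hε
  obtain ⟨k, hk⟩ := exists_pow_lt_of_lt_one hε hp1
  refine ⟨(p : ℝ) ^ (-(k : ℤ)), zpow_pos (by exact_mod_cast hP.out.pos) _, fun {q} hq => ?_⟩
  rw [dist_zero_right] at hq ⊢
  change ‖(PadicBase.toPadic hp).symm q‖ < ε
  -- `q = p^k q'` with `q' ∈ ℤ_p`
  have hpk : ((p : ℚ_[p]) ^ k) ≠ 0 := pow_ne_zero _ (by exact_mod_cast hP.out.ne_zero)
  set q' : ℚ_[p] := q / (p : ℚ_[p]) ^ k with hq'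
  have hqq' : q = (p : ℚ_[p]) ^ k * q' := by rw [hq', mul_div_cancel₀ _ hpk]
  have hp0r : (0 : ℝ) < p := by exact_mod_cast hP.out.pos
  have hpk_norm : ‖(p : ℚ_[p]) ^ k‖ = (p : ℝ) ^ (-(k : ℤ)) := by
    rw [norm_pow, Padic.norm_p, inv_pow, ← zpow_natCast, ← zpow_neg]
  have hq'1 : ‖q'‖ ≤ 1 := by
    rw [hq', norm_div, hpk_norm, div_le_one (zpow_pos hp0r _)]
    exact hq.le
  have h1 : ‖(PadicBase.toPadic hp).symm q'‖ ≤ 1 :=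
    (PadicBase.norm_le_one_iff hp _).mpr (by simpa using hq'1)
  rw [hqq', map_mul, map_pow, map_natCast, norm_mul, norm_pow]
  calc ‖(p : PadicBase F p hp)‖ ^ k * ‖(PadicBase.toPadic hp).symm q'‖
      ≤ ‖(p : PadicBase F p hp)‖ ^ k * 1 := mul_le_mul_of_nonneg_left h1 (pow_nonneg hp0.le k)
    _ < ε := by rw [mul_one]; exact hk

/-- **The `p`-adic logarithm is continuous on the units**: `‖log_p u − log_p u₀‖ ≤ ‖u − u₀‖` for units at
distance `≤ p⁻¹` (`u/u₀` is a principal unit and `‖L(y)‖ ≤ ‖1 − y‖` on `‖1 − y‖ ≤ p⁻¹`,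
tree `IUT.LogVolume.norm_logSeries_le_norm`). [cite: Koblitz1984, Ch. IV §1] -/
theorem continuousOn_unitLog_sphere :
    ContinuousOn (Literature.IUT.LogVolume.unitLog (K := ℚ_[p])) {u : ℚ_[p] | ‖u‖ = 1} := by
  have hP : p.Prime := Fact.out
  have hp1 : (1 : ℝ) < p := by exact_mod_cast hP.one_lt
  have hp0 : (0 : ℝ) < p := by linarith
  -- `ρ = p⁻¹` satisfies `ρ p^{1/(p-1)} ≤ 1`
  have hθ : (p : ℝ)⁻¹ * (p : ℝ) ^ (1 / ((p : ℝ) - 1)) ≤ 1 := by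
    rw [← Real.rpow_neg_one, ← Real.rpow_add hp0]
    refine Real.rpow_le_one_of_one_le_of_nonpos hp1.le ?_
    have h2 : (2 : ℝ) ≤ p := by exact_mod_cast hP.two_le
    have : 1 / ((p : ℝ) - 1) ≤ 1 := by rw [div_le_one (by linarith)]; linarith
    linarith
  rw [Metric.continuousOn_iff]
  intro u₀ hu₀ ε hε
  refine ⟨min ε (p : ℝ)⁻¹, lt_min hε (inv_pos.mpr hp0), fun u hu hdist => ?_⟩
  rw [Set.mem_setOf_eq] at hu hu₀
  have hu0 : u₀ ≠ 0 := norm_pos_iff.mp (by rw [hu₀]; exact one_pos)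
  rw [dist_eq_norm] at hdist ⊢
  -- `v = u / u₀` is a principal unit with `‖1 - v‖ = ‖u - u₀‖`
  set v : ℚ_[p] := u * u₀⁻¹ with hv
  have h1v : ‖1 - v‖ = ‖u - u₀‖ := by
    have : 1 - v = -((u - u₀) * u₀⁻¹) := by rw [hv]; field_simp; ring
    rw [this, norm_neg, norm_mul, norm_inv, hu₀, inv_one, mul_one]
  have hvP : Literature.IUT.LogVolume.IsPrincipal v := by
    rw [Literature.IUT.LogVolume.isPrincipal_iff, h1v]
    exact lt_of_lt_of_le (lt_of_lt_of_le hdist (min_le_right _ _)) (inv_le_one_of_one_le₀ hp1.le)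
  have hui : ‖u₀⁻¹‖ = 1 := by rw [norm_inv, hu₀, inv_one]
  have hlog : Literature.IUT.LogVolume.unitLog u - Literature.IUT.LogVolume.unitLog u₀ =
      Literature.IUT.LogVolume.logSeries v := by
    rw [← Literature.IUT.LogVolume.unitLog_of_isPrincipal p hvP, hv,
      Literature.IUT.LogVolume.unitLog_mul p hu hui, Literature.IUT.LogVolume.unitLog_inv p hu₀, sub_eq_add_neg]
  rw [hlog]
  calc ‖Literature.IUT.LogVolume.logSeries v‖ ≤ ‖1 - v‖ :=
        Literature.IUT.LogVolume.norm_logSeries_le_norm p ℚ_[p] hθ (by rw [h1v]; exact (lt_of_lt_of_le hdist (min_le_right _ _)).le)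
    _ = ‖u - u₀‖ := h1v
    _ < ε := lt_of_lt_of_le hdist (min_le_left _ _)

/-- `log χ_cyclo : G₀ → K₀`, `g ↦ log_p χ(g)` (read in `K₀ ≅ ℚ_p`). Continuity: `χ` is continuous for the Krull
topology (Mathlib `cyclotomicCharacter.continuous`), `log_p` is continuous on the units, `ℚ_p ≅ K₀` is continuous.
[cite: Tate1967, §3.3] [cite: Kato1993LNM1553, Ch. II §1.2.2] -/
theorem continuous_logChi :
    Continuous fun g : BaseGaloisGroup hp => (PadicBase.toPadic hp).symm
      (Literature.IUT.LogVolume.unitLog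
        (((BaseGaloisGroup.baseCyclotomicCharacter hp g : ℤ_[p]ˣ) : ℤ_[p]) : ℚ_[p])) := by
  have hχ : Continuous (BaseGaloisGroup.baseCyclotomicCharacter hp : BaseGaloisGroup hp → ℤ_[p]ˣ) :=
    cyclotomicCharacter.continuous p (PadicBase F p hp) (NormedAlgClosure F)
  have hcoe : Continuous fun g : BaseGaloisGroup hp =>
      (((BaseGaloisGroup.baseCyclotomicCharacter hp g : ℤ_[p]ˣ) : ℤ_[p]) : ℚ_[p]) :=
    have h1 : Continuous ((↑) : ℤ_[p] → ℚ_[p]) := continuous_subtype_val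
    have h2 : Continuous (Units.val : ℤ_[p]ˣ → ℤ_[p]) := Units.continuous_val
    (h1.comp h2).comp hχ
  have hmem : ∀ g : BaseGaloisGroup hp,
      (((BaseGaloisGroup.baseCyclotomicCharacter hp g : ℤ_[p]ˣ) : ℤ_[p]) : ℚ_[p]) ∈ {u : ℚ_[p] | ‖u‖ = 1} :=
    fun g => by rw [Set.mem_setOf_eq, ← PadicInt.norm_def]; exact PadicInt.isUnit_iff.1 (Units.isUnit _)
  exact (continuous_toPadic_symm hp).comp ((continuousOn_unitLog_sphere (p := p)).comp_continuous hcoe hmem)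

/-- `log χ_cyclo` is additive on `G₀`. [cite: Kato1993LNM1553, Ch. II §1.2.2] -/
theorem logChi_mul (g h : BaseGaloisGroup hp) :
    (PadicBase.toPadic hp).symm (Literature.IUT.LogVolume.unitLog
        (((BaseGaloisGroup.baseCyclotomicCharacter hp (g * h) : ℤ_[p]ˣ) : ℤ_[p]) : ℚ_[p])) =
      (PadicBase.toPadic hp).symm (Literature.IUT.LogVolume.unitLog
        (((BaseGaloisGroup.baseCyclotomicCharacter hp g : ℤ_[p]ˣ) : ℤ_[p]) : ℚ_[p])) +
      (PadicBase.toPadic hp).symm (Literature.IUT.LogVolume.unitLog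
        (((BaseGaloisGroup.baseCyclotomicCharacter hp h : ℤ_[p]ˣ) : ℤ_[p]) : ℚ_[p])) := by
  have hnorm : ∀ u : ℤ_[p]ˣ, ‖((u : ℤ_[p]) : ℚ_[p])‖ = 1 := fun u => by
    rw [← PadicInt.norm_def]; exact PadicInt.isUnit_iff.1 u.isUnit
  rw [← map_add, map_mul, Units.val_mul, PadicInt.coe_mul, Literature.IUT.LogVolume.unitLog_mul p (hnorm _) (hnorm _)]

/-- `log χ_cyclo` kills `H = Gal(F̄/K_∞)` (there `χ = 1`). [cite: Tate1967, §3.3] -/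
theorem logChi_eq_zero_of_forall_smul_zeta {h : BaseGaloisGroup hp} (hh : ∀ M, h • zeta F p M = zeta F p M) :
    (PadicBase.toPadic hp).symm (Literature.IUT.LogVolume.unitLog
        (((BaseGaloisGroup.baseCyclotomicCharacter hp h : ℤ_[p]ˣ) : ℤ_[p]) : ℚ_[p])) = 0 := by
  rw [chi_eq_one_of_forall_smul_zeta hp hh, Units.val_one, PadicInt.coe_one, Literature.IUT.LogVolume.unitLog_one p,
    map_zero]

/-- `log χ_cyclo(γ) ≠ 0` for `γ = gen n`, `n ≥ 2` (`χ(γ)` is not a root of unity, tree `zpow_chi_gen_ne_one`;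
`log_p u = 0 ⇔ u` is torsion, tree `unitLog_eq_zero_iff`). [cite: Tate1967, §3.3] -/
theorem logChi_gen_ne_zero {n : ℕ} (hn : 2 ≤ n) :
    (PadicBase.toPadic hp).symm (Literature.IUT.LogVolume.unitLog
        (((BaseGaloisGroup.baseCyclotomicCharacter hp (gen hp n) : ℤ_[p]ˣ) : ℤ_[p]) : ℚ_[p])) ≠ 0 := by
  intro h0
  have hnorm : ‖(((BaseGaloisGroup.baseCyclotomicCharacter hp (gen hp n) : ℤ_[p]ˣ) : ℤ_[p]) : ℚ_[p])‖ = 1 := by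
    rw [← PadicInt.norm_def]; exact PadicInt.isUnit_iff.1 (Units.isUnit _)
  have hlog : Literature.IUT.LogVolume.unitLog
      (((BaseGaloisGroup.baseCyclotomicCharacter hp (gen hp n) : ℤ_[p]ˣ) : ℤ_[p]) : ℚ_[p]) = 0 :=
    (PadicBase.toPadic hp).symm.injective (by rw [map_zero]; exact h0)
  obtain ⟨m, hm, hum⟩ := (Literature.IUT.LogVolume.unitLog_eq_zero_iff p ℚ_[p] hnorm).mp hlog
  have hum' : ((BaseGaloisGroup.baseCyclotomicCharacter hp (gen hp n) : ℤ_[p]ˣ) : ℤ_[p]) ^ m = 1 := by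
    apply Subtype.ext; push_cast; exact hum
  exact zpow_chi_gen_ne_one hp (n := n) hn (j := (m : ℤ)) (by exact_mod_cast hm.ne')
    (by rw [zpow_natCast, ← map_pow, hum', map_one])

/-! ### Tate's theorem: the `H¹` line is `ℚ_p · log χ_cyclo` -/

variable {f : BaseGaloisGroup hp → CompletedAlgClosure F}

/-- **Tate 1967 §3.3 Theorem 1 (line part), PROVED: a continuous `1`-cocycle `f : Gal(F̄/ℚ_p) → ℂ_F` trivial on
`H = Gal(F̄/ℚ_p(μ_{p^∞}))` is `c · log χ_cyclo + ∂b`**, `c ∈ ℚ_p`, `b ∈ ℂ_F`: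
`f(g) = ι(c · log_p χ(g)) + (g • b − b)` for all `g`. (`TateH1.exists_eq_mul_add_coboundary` at
`λ = log χ_cyclo`, `n = 2`.) [cite: Tate1967, §3.3 Theorem 1] [cite: FontaineOuyang2022, §3.2 Thm. 3.21] -/
theorem exists_eq_mul_logChi_add_coboundary
    (hcoc : ∀ g h : BaseGaloisGroup hp, f (g * h) = f g + g • f h)
    (hH : ∀ h : BaseGaloisGroup hp, (∀ M, h • zeta F p M = zeta F p M) → f h = 0)
    (hcont : Continuous f) :
    ∃ (c : PadicBase F p hp) (b : CompletedAlgClosure F), ∀ g : BaseGaloisGroup hp,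
      f g = ι hp (c * (PadicBase.toPadic hp).symm (Literature.IUT.LogVolume.unitLog
        (((BaseGaloisGroup.baseCyclotomicCharacter hp g : ℤ_[p]ˣ) : ℤ_[p]) : ℚ_[p]))) + (g • b - b) :=
  exists_eq_mul_add_coboundary hp (n := 2) le_rfl hcoc hH hcont _ (logChi_mul hp)
    (fun _ hh => logChi_eq_zero_of_forall_smul_zeta hp hh) (continuous_logChi hp) (logChi_gen_ne_zero hp le_rfl)

/-- **`H¹_cont(Gal(F̄/ℚ_p), ℂ_F) = ℚ_p · [log χ_cyclo]`, GRANTED the Tate–Sen axiom (TS1) for `ℂ_F`** (Tate 1967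
§3.3 Theorem 1 in full, over the base tower): every continuous `1`-cocycle `f : G₀ → ℂ_F` is
`c · log χ_cyclo + ∂b`. First `f|_{ker χ}` is a coboundary `∂b₀` by `TateSen.baseKer_exists_eq_smul_sub_of_TS1`
(edix-p4, the (TS1) hypothesis DISPLAYED as `hTS`); then `f − ∂b₀` is trivial on `H ⊆ ker χ` and
`exists_eq_mul_logChi_add_coboundary` applies. Injectivity of the line is the tree's
`CompletedAlgClosure.not_exists_smul_eq_add_logCyclotomic`. CONDITIONAL on (TS1) only; no other named fact.
[cite: Tate1967, §3.2 Prop. 9–10 and §3.3 Theorem 1] [cite: BergerColmez2008, Déf. 3.1.3 and Prop. 4.1.1] -/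
theorem exists_eq_mul_logChi_add_coboundary_of_TS1
    (hTS : ∃ K : ℝ, ∀ U : OpenSubgroup (BaseGaloisGroup.baseCyclotomicCharacter hp).ker,
      ∃ α : CompletedAlgClosure F, (∀ u ∈ U, u • α = α) ∧ ‖α‖ ≤ K ∧
        ∑ᶠ q : (BaseGaloisGroup.baseCyclotomicCharacter hp).ker ⧸ U.toSubgroup, q.out • α = 1)
    (hcoc : ∀ g h : BaseGaloisGroup hp, f (g * h) = f g + g • f h) (hcont : Continuous f) :
    ∃ (c : PadicBase F p hp) (b : CompletedAlgClosure F), ∀ g : BaseGaloisGroup hp,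
      f g = ι hp (c * (PadicBase.toPadic hp).symm (Literature.IUT.LogVolume.unitLog
        (((BaseGaloisGroup.baseCyclotomicCharacter hp g : ℤ_[p]ˣ) : ℤ_[p]) : ℚ_[p]))) + (g • b - b) := by
  -- (1) trivialise `f` on `ker χ`
  obtain ⟨b₀, hb₀⟩ := TateSen.baseKer_exists_eq_smul_sub_of_TS1 hp hTS
    (fun h : (BaseGaloisGroup.baseCyclotomicCharacter hp).ker => f h)
    (fun g h => by
      change f ((g : BaseGaloisGroup hp) * h) = f g + (g : BaseGaloisGroup hp) • f h
      exact hcoc g h)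
    (hcont.comp continuous_subtype_val)
  set f₁ : BaseGaloisGroup hp → CompletedAlgClosure F := fun g => f g - (g • b₀ - b₀) with hf₁
  have hcoc₁ : ∀ g h : BaseGaloisGroup hp, f₁ (g * h) = f₁ g + g • f₁ h := fun g h =>
    cocycle_sub_coboundary hp hcoc b₀ g h
  have hH₁ : ∀ h : BaseGaloisGroup hp, (∀ M, h • zeta F p M = zeta F p M) → f₁ h = 0 := by
    intro h hh
    have hker : h ∈ (BaseGaloisGroup.baseCyclotomicCharacter hp).ker := by
      rw [MonoidHom.mem_ker]; exact chi_eq_one_of_forall_smul_zeta hp hh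
    have := hb₀ ⟨h, hker⟩
    change f h = h • b₀ - b₀ at this
    simp only [hf₁, this, sub_self]
  have hcont₁ : Continuous f₁ := hcont.sub ((TateSen.continuous_base_smul_left hp b₀).sub continuous_const)
  obtain ⟨c, b, hb⟩ := exists_eq_mul_logChi_add_coboundary hp hcoc₁ hH₁ hcont₁
  refine ⟨c, b + b₀, fun g => ?_⟩
  have := hb g
  simp only [hf₁] at this
  rw [smul_add]
  linear_combination this

end TateH1

end Literature.NumberTheory.PAdicHodge

end
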